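import Summits.BirchSwinnertonDyer.BirchSwinnertonDyer.Theses.SemiOrdinaryEisensteinDescent
import Summits.BirchSwinnertonDyer.BirchSwinnertonDyer.Theses.UniversalToricDescent
import Summits.BirchSwinnertonDyer.BirchSwinnertonDyer.Theorems.UniversalToricDescentToricTransportModThreeNormProfile
import Summits.BirchSwinnertonDyer.BirchSwinnertonDyer.Theorems.EisensteinPrimesHidaLimitFittingBoundConverse
import Literature.NumberTheory.EllipticCurves.UnrIntegersUnits
import HarnessLib

/-!
# Crux E `WildSplitEisensteinInclusionAtThree` (stmt-BirchSwinnertonDyer-20479) REPLACES route UTD's wall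
# `AdditiveSplitIMCInclusionAtThree` (stmt-BirchSwinnertonDyer-20395) in UTD's Greenberg–Vatsal glue:
# E → `InvariantsTransportModThree` → `TwinMuZeroAtThree` → `ToricTransportModThree` BY NAME — a CROSS-ROUTE
# kernel identity (UTD's twin leaf from E and UTD's other items: companion file `…ReplacesToricWallLeaf.lean`)
# (cell `pub/bsd-wall`, width seat `bsd-wall-soed-p1-w3` g0, `--supports 20479`, helper)

Routes `SemiOrdinaryEisensteinDescent` (SOED, rev 5) and `UniversalToricDescent` (UTD, rev 20) attack the same
W-ALL leaf family (non-CM `E/ℚ` wild at `3`, `ρ̄_{E,3}` onto, `r_an = 1`) and each posits ONE inclusion of the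
`(∅,0)` anticyclotomic main conjecture for `f_E` at the additive point as a research crux, with the SAME binders
(UTD 20395 = SOED 20479 «binders verbatim, conclusion reversed, torsion guard added»):
* UTD's wall `AdditiveSplitIMCInclusionAtThree` (S_div, 20395): `(L) ⊆ Ch_Λ(X_(∅,0))·R₀⟦T⟧` («⊇», Euler-system side);
* SOED's crux E `WildSplitEisensteinInclusionAtThree` (20479): `X_(∅,0)` torsion `→ Ch_Λ(X_(∅,0))·R₀⟦T⟧ ⊆ (L)`
  («⊆», Eisenstein side).
UTD closes its crux #2 `ToricTransportModThree` (20186, the EQUALITY at the additive point) by the landed glue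
`ToricTransportModThreeOfWallPieces` (p-`toricTransportModThreeOfWallPieces_proof`): S_div + the Greenberg–Vatsal
transport of the norm profile (`InvariantsTransportModThree`, 20399) + `μ = 0` for the twin (`TwinMuZeroAtThree`,
20400) ⇒ equality, through the closing algebra `UniversalToricDescentNormProfile.span_eq_span_of_dvd_of_normProfile`
(p531417: ONE divisibility + equal norm profile ⇒ equality of principal ideals of `R₀⟦T⟧`).

THIS FILE certifies that the closing algebra is SYMMETRIC in the two inclusions, so SOED's crux E can stand in
for UTD's wall:

* §1 `span_singleton_eq_top_of_normProfile_of_span_singleton_eq_top` — the degenerate branch of the profile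
  algebra: if `(g) = R₀⟦T⟧` and `g`, `L` share the norm profile `n` (no norm-one coefficient below `n`, a norm-one
  coefficient at `n`) then `n = 0` and `(L) = R₀⟦T⟧` (a unit of `R₀⟦T⟧` has a unit, i.e. norm-one, constant term:
  `PowerSeries.isUnit_iff_constantCoeff`, `unrIntegers.isUnit_iff_norm_eq_one`).
* §2 **`toricTransportModThree_of_wildSplitEisensteinInclusionAtThree :
  SOED.WildSplitEisensteinInclusionAtThree → UTD.InvariantsTransportModThree → UTD.TwinMuZeroAtThree →
  UTD.ToricTransportModThree`** — BY NAME over both route files. Proof: at a frame `L` of `f_E`, 20399 (fed by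
  20400) gives `Ch·R₀⟦T⟧ = (g)` with `g` and `L` of the same norm profile `n`; if `X_(∅,0)` is `Λ`-torsion, E
  gives `(g) ⊆ (L)`, i.e. `L ∣ g`, and `span_eq_span_of_dvd_of_normProfile` WITH THE ROLES OF `g` AND `L`
  SWAPPED gives `(L) = (g)`; if `X_(∅,0)` is NOT torsion, the tree's characteristic ideal is `Λ` by its junk-value
  convention (`charIdeal_eq_top_of_not_isTorsion`, bsd-eis), so `(g) = R₀⟦T⟧`, and §1 gives `(L) = R₀⟦T⟧` too — the
  torsion guard of E costs nothing here.
* (companion file `…ReplacesToricWallLeaf.lean`, kept apart because it must import UTD's kernel module, which lies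
  in UTD's `Theses` cone) UTD's registered leaf `Summit.BirchSwinnertonDyer.WAllExclAddWildRankOneSurjTwin` from
  `ToricPublishedInputs`, SOED's E, 20399, 20400, 20214, 20385, 20386, 20387 — UTD's deciding theorem `closes` with
  §2 in place of S_div. So for UTD's leaf the two research walls S_div (UTD «⊇») and E (SOED «⊆») are
  INTERCHANGEABLE modulo the transport items 20399/20400; conversely S_div + 20399 + 20400 give the equality
  (UTD's glue), hence E's conclusion, at every TWIN-COMPATIBLE datum (`K` Heegner for `N(E)` and `N(E′)`) — not E
  as typed (all Heegner `K` for `N(E)`), which is why no by-name converse is stated.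

HONEST STATUS: nothing here is progress on E itself (the LEVER `stub_semiOrdinaryTransferUpToPPower` stays
research, Hsieh 2014 Thm. B stays a named fact); 20399 is itself conjecture-grade at `9 ∣ N`. No definition, no
named fact, no `sorry`; BSD is not proved for any curve by any of this. Supports, does not close,
stmt-BirchSwinnertonDyer-20479.

References: [GreenbergVatsal2000] Thm. 1.4 (shape of the `(μ, λ)`-transport); [JetchevSkinnerWan2017] §7.4
(the two halves); [Washington1997] §7.1 (units of `A⟦T⟧`), §13.2 (characteristic ideals); folklore.
-/

set_option autoImplicit false
set_option linter.dupNamespace false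

noncomputable section

open scoped Classical

namespace Summit.BirchSwinnertonDyer.BirchSwinnertonDyer.Theorems.WildSplitEisensteinInclusionAtThreeReplacesToricWall

open PowerSeries Literature.NumberTheory.EllipticCurves
  Summit.BirchSwinnertonDyer.Rank1Residual.X11b
  Summit.BirchSwinnertonDyer.BirchSwinnertonDyer.Theorems
  Summit.BirchSwinnertonDyer.BirchSwinnertonDyer.Theorems.UniversalToricDescentNormProfile

/-! ### §1 The degenerate branch of the norm-profile algebra -/

section Algebra

variable {p : ℕ} [Fact p.Prime]

/-- A unit of `R₀⟦T⟧` has a constant term of norm one in `ℂ_p` (`PowerSeries.isUnit_iff_constantCoeff`,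
`unrIntegers.isUnit_iff_norm_eq_one`). [folklore] -/
theorem norm_coeff_zero_eq_one_of_isUnit {g : UnrSeries p} (hg : IsUnit g) :
    ‖((PowerSeries.coeff 0 g : unrIntegers p) : ℂ_[p])‖ = 1 := by
  rw [PowerSeries.coeff_zero_eq_constantCoeff]
  exact (unrIntegers.isUnit_iff_norm_eq_one _).mp ((PowerSeries.isUnit_iff_constantCoeff (φ := g)).mp hg)

/-- Conversely, a norm-one constant term makes an element of `R₀⟦T⟧` a unit. [folklore] -/
theorem isUnit_of_norm_coeff_zero_eq_one {L : UnrSeries p}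
    (hL : ‖((PowerSeries.coeff 0 L : unrIntegers p) : ℂ_[p])‖ = 1) : IsUnit L := by
  rw [PowerSeries.coeff_zero_eq_constantCoeff] at hL
  exact (PowerSeries.isUnit_iff_constantCoeff (φ := L)).mpr ((unrIntegers.isUnit_iff_norm_eq_one _).mpr hL)

/-- **Degenerate branch of the profile algebra.** If `(g) = R₀⟦T⟧` while `g` has no norm-one coefficient
below `n` and `L` has a norm-one coefficient at `n`, then `n = 0` and `(L) = R₀⟦T⟧`: the unit `g` has a
norm-one constant term, so `n = 0`, so `L(0)` has norm one and `L` is a unit. [folklore] -/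
theorem span_singleton_eq_top_of_normProfile_of_span_singleton_eq_top {g L : UnrSeries p} {n : ℕ}
    (htop : Ideal.span ({g} : Set (UnrSeries p)) = ⊤)
    (hg : ∀ i < n, ‖((PowerSeries.coeff i g : unrIntegers p) : ℂ_[p])‖ < 1)
    (hL : ‖((PowerSeries.coeff n L : unrIntegers p) : ℂ_[p])‖ = 1) :
    Ideal.span ({L} : Set (UnrSeries p)) = ⊤ := by
  have hg0 : ‖((PowerSeries.coeff 0 g : unrIntegers p) : ℂ_[p])‖ = 1 :=
    norm_coeff_zero_eq_one_of_isUnit (Ideal.span_singleton_eq_top.mp htop)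
  have hn : n = 0 := by
    by_contra hn
    exact absurd hg0 (ne_of_lt (hg 0 (Nat.pos_of_ne_zero hn)))
  subst hn
  exact Ideal.span_singleton_eq_top.mpr (isUnit_of_norm_coeff_zero_eq_one hL)

/-- **The profile algebra read from the EISENSTEIN side.** If `(g) ⊆ (L)` (i.e. `L ∣ g` — the «⊆» inclusion of
crux E at a frame, `(g) = Ch·R₀⟦T⟧`), `L` has no norm-one coefficient below `n` and `g` has a norm-one
coefficient at `n`, then `(g) = (L)`: `span_eq_span_of_dvd_of_normProfile` (p531417) with the roles of `g` and
`L` swapped. [cite: GreenbergVatsal2000, Thm. 1.4 (shape of the transport)] -/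
theorem span_eq_span_of_span_le_of_normProfile' {g L : UnrSeries p} {n : ℕ}
    (hle : Ideal.span ({g} : Set (UnrSeries p)) ≤ Ideal.span {L})
    (hLlt : ∀ i < n, ‖((PowerSeries.coeff i L : unrIntegers p) : ℂ_[p])‖ < 1)
    (hgn : ‖((PowerSeries.coeff n g : unrIntegers p) : ℂ_[p])‖ = 1) :
    Ideal.span ({g} : Set (UnrSeries p)) = Ideal.span {L} :=
  (span_eq_span_of_dvd_of_normProfile
    (Ideal.mem_span_singleton.mp (hle (Ideal.mem_span_singleton_self g))) hLlt hgn).symm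

end Algebra

/-! ### §2 E replaces S_div in UTD's Greenberg–Vatsal glue -/

open Summit.BirchSwinnertonDyer.BirchSwinnertonDyer.Theses in
/-- **SOED's crux E stands in for UTD's wall S_div**: `WildSplitEisensteinInclusionAtThree` (SOED 20479) →
`InvariantsTransportModThree` (UTD 20399) → `TwinMuZeroAtThree` (UTD 20400) → `ToricTransportModThree` (UTD crux #2,
20186), BY NAME. At a frame `L` of `f_E`: 20399 gives `Ch_Λ(X_(∅,0))·R₀⟦T⟧ = (g)` with `g`, `L` of the same norm
profile; if `X_(∅,0)` is `Λ`-torsion, E gives `(g) ⊆ (L)` and `span_eq_span_of_span_le_of_normProfile'` the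
equality; otherwise `Ch = Λ` (`charIdeal_eq_top_of_not_isTorsion`), `(g) = ⊤`, and the degenerate branch gives
`(L) = ⊤`. Compare UTD's own glue `toricTransportModThreeOfWallPieces_proof` (S_div in place of E).
[cite: GreenbergVatsal2000, Thm. 1.4 (shape of the transport)] -/
theorem toricTransportModThree_of_wildSplitEisensteinInclusionAtThree
    (hE : SemiOrdinaryEisensteinDescent.WildSplitEisensteinInclusionAtThree)
    (hinv : UniversalToricDescent.InvariantsTransportModThree)
    (hμ : UniversalToricDescent.TwinMuZeroAtThree) :
    UniversalToricDescent.ToricTransportModThree := by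
  intro W _ _ W' _ _ N N' _ _ K _ _ Dt Dt' hO6 honto hr hN hcong haddv hN' hK hH hH' κ hκ γ _ 𝔭 h𝔭
    he hf 𝔭' h𝔭' hne ι' hι' hex heq' ΩK Ωp L hΩK hΩp hL
  have hμ' := hμ W W' N N' K Dt Dt' hO6 honto hr hN hcong haddv hN' hK hH hH' κ hκ γ 𝔭 h𝔭 he hf 𝔭' h𝔭' hne ι' hι'
  obtain ⟨g, n, hI, hg, hgn, hLlt, hLn⟩ := hinv W W' N N' K Dt Dt' hO6 honto hr hN hcong haddv hN' hK hH hH'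
    κ hκ γ 𝔭 h𝔭 he hf 𝔭' h𝔭' hne ι' hι' hex heq' hμ' ΩK Ωp L hΩK hΩp hL
  rw [hI]
  by_cases htor : Module.IsTorsion (IwasawaAlgebra 3) (AcSelmer.XAc (W.baseChange K) 3 κ 𝔭' ∅ γ)
  · -- torsion: crux E gives `(g) = Ch·R₀⟦T⟧ ⊆ (L)`, i.e. `L ∣ g`; profile algebra with roles swapped
    have hle := hE W N K Dt hO6 honto hr hN hK hH κ hκ γ 𝔭 h𝔭 he hf 𝔭' h𝔭' hne ι' hι' ΩK Ωp L hΩK hΩp hL htor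
    rw [hI] at hle
    exact span_eq_span_of_span_le_of_normProfile' hle hLlt hgn
  · -- not torsion: `Ch = Λ` (junk-value convention), so `(g) = ⊤` and then `(L) = ⊤`
    have htop : AcSelmer.XAc.charIdeal (W.baseChange K) 3 κ 𝔭' ∅ γ = ⊤ :=
      charIdeal_eq_top_of_not_isTorsion (p := 3) _ htor
    have hgtop : Ideal.span ({g} : Set (UnrSeries 3)) = ⊤ := by rw [← hI, htop, Ideal.map_top]
    rw [hgtop, span_singleton_eq_top_of_normProfile_of_span_singleton_eq_top hgtop hg hLn]

end Summit.BirchSwinnertonDyer.BirchSwinnertonDyer.Theorems.WildSplitEisensteinInclusionAtThreeReplacesToricWall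

end
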